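import Mathlib
import HarnessLib
import HarnessLib.Audit
import Summits.AtomisticToContinuum.Statement
import Literature.MathematicalPhysics.KineticTheory.InfiniteChainDynamics
import Literature.MathematicalPhysics.KineticTheory.InfiniteChainInvariantStates
import Summits.AtomisticToContinuum.FouriersLaw.Theorems.JunctionLocalitySuperadditiveFekete
import Summits.AtomisticToContinuum.FouriersLaw.Theorems.EmbeddedDrudeMourreNessUnique
import Summits.AtomisticToContinuum.FouriersLaw.Theorems.OddSectorIrreversibilityBoundedResponseConvergesStubPositiveConductance
import Summits.AtomisticToContinuum.FouriersLaw.Theorems.FourierGreenKuboFourierFiniteResponseOfUnique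
import Summits.AtomisticToContinuum.FouriersLaw.Theorems.ContactEchoEpochsPinnedSteadyStateExists
import HarnessLib.Audit.Status.Attr

/-!
Route: LogConcaveRigidity

# Route LogConcaveRigidity — convexity is KAM-blind — Liouville for heat in the Borell log-concave
class + N-uniform window log-concavity of the NESS, junction-glued to κ

X = X_LC ∧ X_A ∧ X_J ("it suffices to show"), realising card log-concave-rigidity-kam-blind (graded
new-mechanism, unrouted) as a
conforming crux-only route whose deciding theorem is PROVED (glue.lean, rc 0, axioms
propext/Classical.choice/Quot.sound). X_LC (THE NEW
RIGIDITY HALF): LogConcaveLiouville — every probability measure on (ℝ×ℝ)^ℤ that is time-invariant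
for the infinite deterministic pinned chain
(∫𝒜f dν = 0), translation-BOUNDED (site-uniform moments) and WINDOW-LOG-CONCAVE in Borell's sense
(every box marginal m satisfies
m(θA+(1−θ)B) ≥ m(A)^θ m(B)^(1−θ), Borel A, B, 0<θ<1 — the class of (possibly degenerate) log-concave
measures, closed under marginals and
weak limits) carries zero mean bond current — together with NessWindowLogConcavity (for every T>0 a
width δ₀(T)>0 such that for bias
0<δ<δ₀ EVERY window marginal of EVERY weak steady state of the N-chain at (T+δ/2, T−δ/2) is
Borell-log-concave, uniformly in N and in the
window position). X_A (a priori, shared): NessTightness. X_J (junction half, shared verbatim with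
ParityLiouvilleSeed / JunctionLocality):
UniformLinearRegime, SuperadditiveResistance and ConductanceLowerBound, plus the glue-crux
LogConcaveWindowLimit (bulk-window compactness
INSIDE the log-concave class: Prokhorov + stationarity transfer + Borell closedness; provable,
ranked last). The five fixed-N / real-analysis
supports (NessUnique, PinnedSteadyStateExists, FiniteResponseOfUnique, PositiveConductance,
SuperadditiveFekete) are already PROVED in tree and
are INVOKED inside `closes` (crux-only deciding theorem), not filed as items.
Lean: `LogConcaveLiouville ∧ NessWindowLogConcavity ∧ NessTightness ∧ UniformLinearRegime ∧
SuperadditiveResistance ∧ ConductanceLowerBound ∧ LogConcaveWindowLimit`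

## Assembly
The deciding theorem `theorem closes (hLCL : LogConcaveLiouville) (hNLC : NessWindowLogConcavity)
(hT : NessTightness) (hU : UniformLinearRegime)
(hA : SuperadditiveResistance) (hCL : ConductanceLowerBound) (hW : LogConcaveWindowLimit) :
_root_.FouriersLaw` is CRUX-ONLY (every hypothesis
is a crux item, every crux is used) and PROVED sorry-free in the planner folder (SketchGlue2.lean /
glue2.lean, lean check rc 0, axioms
propext / Classical.choice / Quot.sound). The fixed-N frame is invoked from the tree inside the
proof: nessUnique_proof
(Theorems.EmbeddedDrudeMourreNessUnique), pinnedSteadyStateExists_proof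
(Theorems.ContactEchoEpochsPinnedSteadyStateExists),
FourierGreenKubo.finiteResponseOfUnique_holds,
TwoScaleGluingLogRigidity.Stubs.positiveConductance_holds, superadditiveFekete_proof
(Theorems.JunctionLocalitySuperadditiveFekete) — the same Props verbatim, so application unfolds
them. Clause (i) from existence + uniqueness.
STEP A (near-equilibrium rung, in-proof): for T > 0 take the width δ₀(T) of NessWindowLogConcavity;
for 0 < δ < δ₀ with T − δ/2 > 0 and any
steady family ν at (T+δ/2, T−δ/2), if totalCurrent(ν_N)/(N−1) ↛ 0 then Metric.tendsto_nhds gives ε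
and "frequently ε ≤ |J̃_N|";
NessTightness gives the moments, NessWindowLogConcavity the Borell inequality of every finite-N
window, so LogConcaveWindowLimit produces a
time-invariant, translation-bounded, window-log-concave ν_∞ with ε ≤ |∫ j₀ dν_∞| — contradicting
LogConcaveLiouville. STEP B: canonical
family by Classical.choose; for T > 0 the proved finite response gives D, positiveConductance_holds
/ ConductanceLowerBound /
SuperadditiveResistance their constants; NOT BALLISTIC for D: given ε, N₀ take δ₀ᵁ from
UniformLinearRegime at ε/4 and δ₁ from STEP A,
δ := min(min(δ₀ᵁ/2, T), δ₁/2), apply STEP A to get N ≥ max(N₀,2) with |J̃_N| < (ε/4)δ(N−1), whence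
D_N ≤ |D_N − J/δ| + |J/δ| ≤ ε(N−1);
superadditiveFekete_proof then gives κ_T > 0 with D → κ_T. STEP C: κ(T) := κ_T (1 for T ≤ 0); for an
arbitrary steady family uniqueness
makes the difference quotients agree for |δ| < 2T (Filter.Tendsto.congr'), so the same D serves it.

Rationale: WHY THIS LINE. Every anti-ballistic / hydrodynamic line needs a Gibbs characterisation of stationary
states of the INFINITE deterministic chain, and the
one recorded obstruction to it (FritzFunakiLebowitz1994 p. 215; Bernardin2014 Def. 1; barrier
MacroErgodicityHypothesis) is KAM: locally
absolutely continuous invariant states modulated across Cantor families of invariant tori, invisible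
to entropy ("regular") hypotheses. The
lever imported from CONVEX GEOMETRY / Brunn–Minkowski theory (Prékopa 1973, BrascampLieb1976 Thm 4.3
and §6, Borell1975, SaumardWellner2014
§3) is to run the Liouville theorem for heat in the class of LOG-CONCAVE STATES instead: (P)
log-concavity of box marginals passes EXACTLY to
sub-windows and to weak limits (Prékopa; Borell's multiplicative Brunn–Minkowski form is weakly
closed), so it is inherited by bulk limits of
steady-state windows with no relative-entropy bookkeeping; (L) it is KAM-BLIND — a semiconvex
function locally constant on a dense open set is
constant (staircase lemma, proved on the card), measures on Cantor families of tori or on breather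
orbits have non-convex window supports and
are outside the class by fiat, and inside it a current needs a C^{1,1}-tame momentum-ODD conserved
functional riding under a convex EVEN one
(even/odd domination); (M) non-degenerate temperature mixtures are NOT log-concave on large boxes,
so bulk limits in the class are pure
phases for free. The bridge to the bathed chain is NessWindowLogConcavity, a ONE-SIDED second-order
statement about the actual NESS near
equilibrium — true at δ = 0 precisely because the conjunct's hypotheses ω₂, lam, β > 0 are exactly
what makes H uniformly convex
(Hess H ≥ min(1,ω₂)), true for the harmonic member (Gaussian NESS, RiederLebowitzLieb) and for N = 1
(Gibbs at the mean temperature), and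
MD-checkable. The delimiter is right: at lam = β = 0 NessWindowLogConcavity holds while
LogConcaveLiouville FAILS (SpohnLebowitz1977
radiating Gaussian states are log-concave, stationary, current-carrying), so anharmonicity must be
used in the rigidity crux alone,
consistent with `not_fouriersLawFor_harmonic`. What no open route does: all 38 work with spectral /
correlation / variational / kinetic /
locality objects or (ParityLiouvilleSeed, ThermostatLiouville, CurrentTiltQuench) with rigidity in
the REGULAR or tempered-functional class;
none uses a convexity class of STATES, and the Cesàro-over-shifts upgrade those routes rely on is
unavailable here (mixtures are not
log-concave) — the Liouville theorem is asked directly in translation-bounded form, in a class where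
FFL94's obstruction is provably empty.

RANKED CRUXES. #2 LogConcaveLiouville (crux) — LIOUVILLE THEOREM FOR HEAT IN THE BORELL LOG-CONCAVE
CLASS (card K1, odd sector, translation-bounded form): for ω₂, lam, β > 0 (γ inert) every
probability measure ν on ChainConfig = (ℝ×ℝ)^ℤ that is time-invariant for the infinite pinned chain
(IsTimeInvariant: ∫𝒜f dν = 0 for local C¹ tests), has site-uniform polynomial moments, and whose
every box marginal boxMarginal a n ν satisfies Borell's inequality m{θx+(1−θ)y : x∈A, y∈B} ≥
m(A)^θ·m(B)^(1−θ) for Borel A, B and 0<θ<1, has ∫ j₀ dν = 0 (j₀ = bondCurrentZ σ 0).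
Shift-invariance is NOT assumed (Cesàro averaging leaves the class). Gibbs states, the ground-state
Dirac mass and their momentum flips are in the class and carry no current; torus/breather-supported
invariant measures are not in the class. [difficulty: open-problem] (why it might fail: a
window-log-concave stationary non-Gibbs state may exist: e^{−βH−λQ} for a tame quasi-local
momentum-odd conserved Q (hidden charge), or a convex even non-thermal conserved functional in
infinite volume; no engine beyond reduction to the smooth even/odd census.)
[FritzFunakiLebowitz1994, Bernardin2014, SpohnLebowitz1977, BrascampLieb1976, Borell1975, Mazur1969]
#3 NessWindowLogConcavity (crux) — N-UNIFORM NEAR-EQUILIBRIUM WINDOW LOG-CONCAVITY OF THE STEADY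
STATE (card K2, in the weakest form `closes` needs): for pinnedChain ω₂ lam β γ (all > 0) and every
T > 0 there is δ₀ > 0 such that for every bias 0 < δ < δ₀ with T − δ/2 > 0, every N, every weak
steady state μ of the N-chain at (T+δ/2, T−δ/2) and every window {a,…,a+n} ⊆ {0,…,N−1}, the window
marginal of μ satisfies Borell's multiplicative Brunn–Minkowski inequality for all Borel A, B and
0<θ<1 (equivalently, at finite N where densities are smooth and positive: the window density is
e^{−W}, W convex). At δ = 0 it is Prékopa applied to e^{−H/T}, Hess(H/T) ≥ min(1,ω₂)/T; at lam = β =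
0 it is Gaussianity; at N = 1 it is the Gibbs state at the mean temperature. [difficulty: XL] (why
it might fail: exact convexity of −log(window density) is unprotected in the far tails |z| ≳
δ^(-1/2): log-concavity is not propagated by the anharmonic flow, and contact-layer / O(δ²)
long-range corrections to −log ρ can have Hessians misaligned with Hess H, so δ₀ could shrink with N
or vanish.) [TasakiGaspard1995, EckmannPilletReyBellet1999a, BonettoLebowitzReyBellet2000,
BrascampLieb1976, SaumardWellner2014, Villani2009]
#4 NessTightness (crux) — N- AND SITE-UNIFORM MOMENT BOUNDS for every weak steady state at fixed
T_L, T_R > 0 (shared verbatim with ParityLiouvilleSeed stmt-AtomisticToContinuum-13978 /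
SingleThermostatRigidity): supplies Prokhorov tightness and uniform integrability (cubic forces,
quartic currents) for LogConcaveWindowLimit. [difficulty: L] (why it might fail: no N-uniform moment
bound is known for any Hamiltonian-bulk chain (Bernardin2014 §2: 'polynomial in N'); Lyapunov
constants of CEHR2018 grow with N; pinnedChain is the borderline degree 4 = 4 of condition C5.)
[Bernardin2014, CuneoEckmannHairerReyBellet2018, HairerMattingly2009, EckmannPilletReyBellet1999b]
#5 UniformLinearRegime (crux) — N-UNIFORM LINEAR REGIME OF THE PER-BOND CURRENT (shared verbatim
with ParityLiouvilleSeed stmt-AtomisticToContinuum-13979): lim_{δ↓0} limsup_N |J̃_N(δ)/δ − G_N| = 0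
in the form ∀ε ∃δ₀ ∀δ<δ₀ ∀ᶠN |totalCurrent/δ − D_N| ≤ εN; with the near-equilibrium rung (STEP A of
`closes`, which only needs biases below min(δ₀, width of NessWindowLogConcavity)) it yields NOT
BALLISTIC at linear response. [difficulty: L] (why it might fail: fails iff the linear regime
shrinks with N (conductance a function of Nδ, a bias-generated mean free path ~1/δ as at T→0);
nonlinear response does scale with N at large bias (He–Ai–Chan–Hu 2010, NDTR); no N-uniform bound on
any NESS response exists.) [doi:10.1103/physreve.81.041131, KunduDharNarayan2009,
BonettoLebowitzReyBellet2000]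
#6 SuperadditiveResistance (crux) — JUNCTION SUPERADDITIVITY OF THE END-TO-END RESISTANCE R_N =
(N−1)/D_N up to a contact constant (shared verbatim with JunctionLocality / FeketeSeriesLaw /
ParityLiouvilleSeed stmt-AtomisticToContinuum-11748); with ConductanceLowerBound and the proved
PositiveConductance / SuperadditiveFekete (invoked in `closes`) it turns "not ballistic" into D_N →
κ(T) ∈ (0,∞). [difficulty: XL] (why it might fail: junction-repair cost may grow with N, M if
optimal response fields carry junction-crossing coherent structure at all scales (long mean free
path; C(T)↑∞ as T→0 must be allowed); no sign principle is known; fails exactly for superdiffusive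
transport.) [GaudilliereLandim2013, ReyBellet2003, Hammersley1988, arXiv:1105.0493]
#7 ConductanceLowerBound (crux) — OHMIC LOWER BOUND liminf_N D_N ≥ c(T) > 0 — the POSITIVITY half of
κ ∈ (0,∞) (shared verbatim with JunctionLocality / ParityLiouvilleSeed
stmt-AtomisticToContinuum-11749, there a support; promoted to crux here because the crux-only
deciding theorem consumes it and no N-uniform lower bound on the NESS current of a deterministic
anharmonic chain is in print): it caps the Fekete slope (R_N/N ≤ 1/c), i.e. κ ≥ c. Candidate engines
listed on the shared item: linear-response fluctuation-theorem bounds, comparison with the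
energy-conserving-noise chain (BernardinOlla2005), multi-scale pigeonhole on the response profile
(card anti-insulator-kink-rigidity), or the companion SUBadditive half R_{N+M} ≤ R_N + R_M + C'.
[difficulty: XL] (why it might fail: an asymptotically localised regime (pinning ≫ coupling at high
T, DeRoeckHuveneers2015) makes c(T) smaller than any power of the effective coupling; nothing
forbids c = 0 at a given T except physics; no lower-bound technology exists without bulk noise.)
[DeRoeckHuveneers2015, BernardinOlla2005, BonettoLebowitzReyBellet2000]
#8 LogConcaveWindowLimit (crux) — [GLUE-CRUX, provable now (M), ranked last] BULK-WINDOW COMPACTNESS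
INSIDE THE LOG-CONCAVE CLASS (the log-concave twin of the proved WindowLimit
stmt-AtomisticToContinuum-13982): for any parameters, any family (μ_N) of weak steady states at
(T_L,T_R) with site-uniform moments whose finite-N windows all satisfy Borell's inequality, if
frequently ε ≤ |totalCurrent(μ_N)/(N−1)| then some probability ν on (ℝ×ℝ)^ℤ is time-invariant,
translation-bounded, WINDOW-LOG-CONCAVE (Borell), with j₀ integrable and ε ≤ |∫ j₀ dν|. Proof plan:
windows centred at ⌊N/2⌋, Prokhorov from moments, stationarity transfer exactly as in
windowLimit_proof (bath terms do not touch bulk coordinates; bond currents of a steady state all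
equal J̃_N), and Borell closedness: weak limits of measures satisfying the multiplicative
Brunn–Minkowski inequality satisfy it (compact A, B via ε-neighbourhoods and limsup on closed sets,
then inner regularity), and projections to sub-windows preserve it (Prékopa in Borell form is just
the image under a linear map). [deps: NessTightness, NessWindowLogConcavity] [difficulty: M] (why it
might fail: only by a convention mismatch: the finite-N window map (Fin.castLE ∘ Fin.natAdd) vs
boxRestrictAt of the limit, or Borell closedness needing the inequality for compact sets first
(ε-neighbourhoods, limsup on closed sets) and inner regularity — all standard; no mathematical risk
beyond bookkeeping.) [Borell1975, BrascampLieb1976, SaumardWellner2014, EyinkLebowitzSpohn1991,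
KipnisLandim1999]

TWO-LAYER PLAN. LogConcaveLiouville ⇐ (L1) ConditionalIntegral → (L2) ConvexChargeRigidity →
LogConcaveLiouville: (L1) for a window-log-concave time-invariant
translation-bounded ν the window potentials W_Λ = −log(density) solve the projected Liouville
equation {H_Λ, W_Λ} = E[boundary flux | z_Λ]
and, by even/odd domination, the momentum-odd part W_o is C^{1,1}-tame relative to the convex even
part W_e; (L2) census: a tame odd quasi-local
conserved functional of the anharmonic infinite chain vanishes and a convex even one is thermal. My
engine note for (L2): a coercive convex
invariant potential attains its minimum on a compact convex invariant set, which must contain the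
chain's ONLY fixed point (q,p) = 0 (U′, V′
vanish only at 0 since ω₂, lam, β > 0); its 2-jet at 0 is a quadratic integral of the HARMONIC
linearisation — a GGE weight on modes — and
the 4-phonon resonance structure of the quartic terms (cards charges-are-collision-invariants /
resonance-geometry-pinned-band) must force
thermal weights: the place where the smooth census enters. NessWindowLogConcavity ⇐
StrongGibbsWindowLogConcavity (δ = 0, Prékopa,
provable) → CorrectorSemiconvexity (N-uniform relative Hessian bound of the linear corrector on
windows) → NessWindowLogConcavity. The dimer
test ConvexIntegralRigidity(N = 2) of the card (K3) is a kill-test child of (L2), not filed now.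

KILL CRITERIA. A window-log-concave, time-invariant, translation-bounded state of the anharmonic
infinite chain with non-zero current (¬LogConcaveLiouville)
closes the route `refuted:LogConcaveLiouville` and is handed to HiddenChargeMazur as a witness (it
is a hidden odd charge in disguise). An MD or
rigorous counterexample to NessWindowLogConcavity at moderate δ with δ₀(N) → 0 forces a pivot to the
windowed-energy-ball variant (log-concavity
of the window law conditioned on {H_Λ ≤ R}) with the Liouville class re-cut accordingly; failure
only far from equilibrium is harmless (the
crux is near-equilibrium). UniformLinearRegime or SuperadditiveResistance refuted ⇒ shared damage
with ParityLiouvilleSeed / JunctionLocality;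
pivot to the escape-deficit or bounded-response endgames. Any proof of HasBoundedResponse +
BoundedResponseConverges elsewhere moots STEP B;
any proof of LiouvilleForHeat (regular class) does NOT moot this route (different class) but makes
the two rigidity cruxes comparable.

NOT DECOMPOSED YET. The children (L1), (L2), StrongGibbsWindowLogConcavity and
CorrectorSemiconvexity above; the staircase lemma, even/odd domination, N = 1 and
harmonic calibrations and Borell closedness as stand-alone lemmas (they ride with `--supports`);
strong (modulus-c) log-concavity, which
would make NessTightness a COROLLARY of the window crux via Brascamp–Lieb variance iteration
(deliberately not merged: NessTightness is a shared
item); the five proved frame Props are not re-filed as items (they are invoked in `closes` from the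
tree); the dimer convex-integral rigidity (card K3, converse KAM). No regime split in T: δ₀(T) and
all constants may degenerate as T → 0 or ∞.

CHEAPEST FALSIFIER. For LogConcaveLiouville: a literature/known-object lookup — is any stationary
non-Gibbs log-concave state of an anharmonic chain known? (FFL94,
Bernardin2014, SpohnLebowitz1977: only the harmonic radiating states; ground-state Dirac and Gibbs
flips checked here: zero current; bounded
static equilibria other than 0 do not exist for convex U, V by a maximum-principle argument recorded
in NOTES.) For NessWindowLogConcavity:
the MD curvature scan of window log-histograms queued by the card (kit job j004514 of the card's
author: pinnedChain(1,1,1,1), N = 2…16,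
biases (1.2,.8)…(1.9,.1), contacts and mid-chain; the crux dies if the worst positive second
difference at bias (1.2,0.8) grows with N); exact
checks done here: N = 1 (Gibbs at mean T), harmonic corner (Gaussian), δ = 0 (Hess H ≥ min(1,ω₂)).

NUMBERS. Equilibrium modulus of convexity: Hess(H/T) ≥ min(1, ω₂)/T uniformly in N (U″ = ω₂ +
3lam·q² ≥ ω₂, V″ = 1 + 3βr² ≥ 1), inherited by all
window marginals (BrascampLieb1976 Thm 4.3). Harmonic member: NESS Gaussian for every N
(RiederLebowitzLieb 1967 / HarmonicChainBallisticFlux),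
D_N = (N−1)c_N → ∞. Items: 8 (7 cruxes incl. the provable glue-crux ranked 8, 1 assembly); `closes`
has 7 hypotheses, all cruxes, all used; five proved frame theorems invoked from the tree.

DEFINITION REQUESTS. None. Borell log-concavity is INLINED as the multiplicative Brunn–Minkowski
inequality over Mathlib sets and ENNReal.rpow (no Pointwise
notation: the Minkowski combination is written {z | ∃ x ∈ A, ∃ y ∈ B, z = θ • x + (1 − θ) • y});
every other constant exists:
OscillatorChain.IsSteadyState / totalCurrent / pinnedChain / PhaseSpace (FouriersLaw.lean),
ChainConfig / bondCurrentZ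
(InfiniteChainDynamics.lean), IsTimeInvariant / boxMarginal (InfiniteChainInvariantStates.lean),
Fin.castLE / Fin.natAdd (Mathlib).
A reusable `IsLogConcaveMeasure` in Literature/Analysis would shorten three items; not requested
(cosmetic).

Novelty: Searches (2026-08-16; local searchd down — connection reset —, OpenAlex 429; remote crossref/zbMATH
+ galaxy used): crossref/zbmath "log-concave
invariant measure Hamiltonian chain stationary states" (8: Huet 2010 doi:10.1112/s0025579310001361
isometry-invariant LC measures, irrelevant),
"propagation of log-concavity kinetic Fokker-Planck" (0 relevant), "convex first integral
Hamiltonian system" (doi:10.1070/rm9707 Kozlov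
polynomial laws), "log-concavity nonequilibrium stationary state" (doi:10.1214/14-ss107 review
only), "log-concave Gibbs measure marginal
anharmonic lattice" (0 relevant), "log-concavity preserved Vlasov Hamiltonian flow"
(doi:10.1214/25-ecp717 heat flow; Wellner 2013 convolution),
"semiconvex first integral KAM tori rigidity" (0); `lit galaxy search --star all` "log-concave
invariant measure" 0 / "log-concavity of the
stationary" 0 / "convex integral of motion" 0 / "nonequilibrium steady state is log-concave" 0 /
"Prekopa-Leindler" 16 textbooks;
`--star pdf --mode intelligent` on the NessWindowLogConcavity conjecture (12 generic NESS hits: Netz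
PRE 101 022120 (2020) harmonic, Hoover
fractal NESS, Dettmann Lorentz gas — none on convexity of states); `lit frontier
AtomisticToContinuum --since 2022` (30; arXiv:2310.13338
Canestrari–Liverani–Olla deterministic + chaotic forcing, arXiv:2604.14056) and `lit bridges --cross
any` (nothing); the 38 open routes
(levers tabulated in NOTES.md), the 2 FouriersLaw negatives, 20 open + 91 closed cards; plus the
card's own  [refs: 10.1112/s0025579310001361, 10.1070/rm9707, 10.1214/14-ss107, 10.1214/25-ecp717, 10.1007/bf01199023, 2310.13338, 2604.14056, doi:10.1112/s0025579310001361, doi:10.1070/rm9707, doi:10.1214/14-ss107, doi:10.1214/25-ecp717, doi:10.1007/bf01199023, FritzFunakiLebowitz1994, BrascampLieb1976, Borell1975, BorceaBrandenLiggett2007]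

Barriers (technique_class: log-concave-rigidity, convex-analysis, fekete-junction): - technique_class: log-concave-rigidity, convex-analysis, fekete-junction
- Literature.Barriers.AtomisticToContinuum.MacroErgodicityBarrier: engaged and RESTRICTED — only the
odd sector (zero current) of the Gibbs characterisation is consumed, in a class (Borell log-concave,
translation-bounded) where the barrier's recorded obstruction (KAM-type locally a.c. stationary
states, FFL94 p. 215) is empty by convex analysis, not by ergodic theory; the sector-condition /
block-estimate half is never met (no hydrodynamic limit: compactness + Liouville reach the rung,
Fekete reaches κ). Honest residue: LogConcaveLiouville has no infinite-volume engine beyond the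
reduction to the smooth even/odd census; the price is moved to NessWindowLogConcavity, a statement
about the actual bathed chain.
- Literature.Barriers.AtomisticToContinuum.HarmonicChainBallisticFlux: respected as the delimiter —
NessWindowLogConcavity, NessTightness, UniformLinearRegime, SuperadditiveResistance all HOLD at lam
= β = 0 (Gaussian NESS, exact RLL law) while LogConcaveLiouville FAILS there (SpohnLebowitz1977
radiating states are log-concave and current-carrying): the scheme cannot prove the false harmonic
statement and must use lam, β > 0 in the rank-2 crux, consistent with `not_fouriersLawFor_harmonic`.
- Literature.Barriers.AtomisticToContinuum.HasBoundedResponse: not assumed and not attacked by a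
fixed-N tool — the rung gives only D_N = o(N); boundedness and convergence come from the imported
junction comparis

History (route lifecycle, newest last):
- 2026-08-16T19:33:46Z · rev 3: dropped NessUnique, PinnedSteadyStateExists, FiniteResponseOfUnique, PositiveConductance, SuperadditiveFekete — drop the five re-filed frame supports: their Props are PROVED in tree verbatim (nessUnique_proof stmt-0741, pinnedSteadyStateExists_proof stmt-9900, finiteRespo (planner-plan-novel-AtomisticToContinuum-Fourier-51cdba3b-v2-)
- 2026-08-16T19:34:32Z · rev 4: restated Assembly (stmt-AtomisticToContinuum-16568) — restate Assembly to the crux-only chain after dropping the five re-filed frame supports (planner-plan-novel-AtomisticToContinuum-Fourier-51cdba3b-v2-)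
- 2026-08-26T08:25:25Z · DORMANT — reconciler: no traction for 8.4 d (last activity item-evidence-added at 2026-08-17T21:58:01Z); parked, not closed — `ledger route dormant route-AtomisticToConti (operator:999:297377)
- 2026-08-31T00:45:36Z · REACTIVATED (open) — reconciler: reactivated — activity statement-checked at 2026-08-30T23:27:57Z after parking at 2026-08-26T08:25:25Z (operator:999:1425605)

sub-problem: FouriersLaw · status: open · opened planner-plan-novel-AtomisticToContinuum-Fourier-51cdba3b-v2-g7-0 2026-08-16T19:29:21Z · rev 6 · ledger route-AtomisticToContinuum-LogConcaveRigidity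
GENERATED by the gate from the ledger (D-0016/17). Provers cite these decls: `theorem foo : Summit.AtomisticToContinuum.FouriersLaw.Theses.LogConcaveRigidity.<Decl> := …` in Summits/AtomisticToContinuum/FouriersLaw/Theorems/<Name>.lean.
-/

namespace Summit.AtomisticToContinuum.FouriersLaw.Theses.LogConcaveRigidity

open scoped BigOperators Topology Manifold Classical MeasureTheory ProbabilityTheory Matrix InnerProductSpace ComplexConjugate ContinuousMap
open Filter Set Function TopologicalSpace MeasureTheory

attribute [summit_statement] _root_.FouriersLaw

/-- item stmt-AtomisticToContinuum-16560 · crux · rank 2 · open · by planner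
why it might fail: a window-log-concave stationary non-Gibbs state may exist: e^{−βH−λQ} for a tame quasi-local momentum-odd conserved Q (hidden charge), or a convex even non-thermal conserved functional in infinite volume; no engine beyond reduction to the smooth even/odd census.
sources: FritzFunakiLebowitz1994, Bernardin2014, SpohnLebowitz1977, BrascampLieb1976, Borell1975, Mazur1969
[crux] LIOUVILLE THEOREM FOR HEAT IN THE BORELL LOG-CONCAVE CLASS (card K1, odd sector,
translation-bounded form): for ω₂, lam, β > 0 (γ inert) every probability measure ν on ChainConfig =
(ℝ×ℝ)^ℤ that is time-invariant for the infinite pinned chain (IsTimeInvariant: ∫𝒜f dν = 0 for local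
C¹ tests), has site-uniform polynomial moments, and whose every box marginal boxMarginal a n ν
satisfies Borell's inequality m{θx+(1−θ)y : x∈A, y∈B} ≥ m(A)^θ·m(B)^(1−θ) for Borel A, B and 0<θ<1,
has ∫ j₀ dν = 0 (j₀ = bondCurrentZ σ 0). Shift-invariance is NOT assumed (Cesàro averaging leaves
the class). Gibbs states, the ground-state Dirac mass and their momentum flips are in the class and
carry no current; torus/breather-supported invariant measures are not in the class. [difficulty:
open-problem] -/
@[route_item "route-AtomisticToContinuum-LogConcaveRigidity", crux]
def LogConcaveLiouville : Prop :=
  ∀ ω₂ lam β γ : ℝ, 0 < ω₂ → 0 < lam → 0 < β → ∀ ν : MeasureTheory.Measure Literature.MathematicalPhysics.KineticTheory.HeatConduction.ChainConfig, MeasureTheory.IsProbabilityMeasure ν → Literature.MathematicalPhysics.KineticTheory.HeatConduction.IsTimeInvariant (Literature.MathematicalPhysics.KineticTheory.HeatConduction.pinnedChain ω₂ lam β γ) ν → (∀ m : ℕ, ∃ C : ℝ, ∀ x : ℤ, MeasureTheory.Integrable (fun σ => |(σ x).1| ^ m + |(σ x).2| ^ m) ν ∧ ∫ σ, (|(σ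 x).1| ^ m + |(σ x).2| ^ m) ∂ν ≤ C) → (∀ (a : ℤ) (n : ℕ), ∀ (A B : Set (Fin (n + 1) → ℝ × ℝ)) (θ : ℝ), MeasurableSet A → MeasurableSet B → 0 < θ → θ < 1 → (Literature.MathematicalPhysics.KineticTheory.HeatConduction.boxMarginal a n ν) A ^ θ * (Literature.MathematicalPhysics.KineticTheory.HeatConduction.boxMarginal a n ν) B ^ (1 - θ) ≤ (Literature.MathematicalPhysics.KineticTheory.HeatConduction.boxMarginal a n ν) {z | ∃ x ∈ A, ∃ y ∈ B, z = θ • x + (1 - θ) • y}) → MeasureTheory.Integrable (fun σ => (Literature.MathematicalPhysics.KineticTheory.HeatConduction.pinnedChain ω₂ lam β γ).bondCurrentZ σ 0) ν → ∫ σ, (Literature.MathematicalPhysics.KineticTheory.HeatConduction.pinnedChain ω₂ lam β γ).bondCurrentZ σ 0 ∂ν = 0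

/-- item stmt-AtomisticToContinuum-16561 · crux · rank 3 · open · by planner
why it might fail: exact convexity of −log(window density) is unprotected in the far tails |z| ≳ δ^(-1/2): log-concavity is not propagated by the anharmonic flow, and contact-layer / O(δ²) long-range corrections to −log ρ can have Hessians misaligned with Hess H, so δ₀ could shrink with N or vanish.
sources: TasakiGaspard1995, EckmannPilletReyBellet1999a, BonettoLebowitzReyBellet2000, BrascampLieb1976, SaumardWellner2014, Villani2009
[crux] N-UNIFORM NEAR-EQUILIBRIUM WINDOW LOG-CONCAVITY OF THE STEADY STATE (card K2, in the weakest
form `closes` needs): for pinnedChain ω₂ lam β γ (all > 0) and every T > 0 there is δ₀ > 0 such that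
for every bias 0 < δ < δ₀ with T − δ/2 > 0, every N, every weak steady state μ of the N-chain at
(T+δ/2, T−δ/2) and every window {a,…,a+n} ⊆ {0,…,N−1}, the window marginal of μ satisfies Borell's
multiplicative Brunn–Minkowski inequality for all Borel A, B and 0<θ<1 (equivalently, at finite N
where densities are smooth and positive: the window density is e^{−W}, W convex). At δ = 0 it is
Prékopa applied to e^{−H/T}, Hess(H/T) ≥ min(1,ω₂)/T; at lam = β = 0 it is Gaussianity; at N = 1 it
is the Gibbs state at the mean temperature. [difficulty: XL] -/
@[route_item "route-AtomisticToContinuum-LogConcaveRigidity", crux]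
def NessWindowLogConcavity : Prop :=
  ∀ ω₂ lam β γ : ℝ, 0 < ω₂ → 0 < lam → 0 < β → 0 < γ → ∀ T : ℝ, 0 < T → ∃ δ₀ : ℝ, 0 < δ₀ ∧ ∀ δ : ℝ, 0 < δ → δ < δ₀ → 0 < T - δ / 2 → ∀ (N : ℕ) (μ : MeasureTheory.Measure (Literature.MathematicalPhysics.KineticTheory.HeatConduction.PhaseSpace N)), (Literature.MathematicalPhysics.KineticTheory.HeatConduction.pinnedChain ω₂ lam β γ).IsSteadyState N (T + δ / 2) (T - δ / 2) μ → ∀ (a n : ℕ) (h : a + (n + 1) ≤ N), ∀ (A B : Set (Fin (n + 1) → ℝ × ℝ)) (θ : ℝ), MeasurableSet A → MeasurableSet B → 0 < θ → θ < 1 → (μ.map (fun x => fun i : Fin (n + 1) => (x.1 (Fin.castLE h (Fin.natAdd a i)), x.2 (Fin.castLE h (Fin.natAdd a i))))) A ^ θ * (μ.map (fun x => fun i : Fin (n + 1) => (x.1 (Fin.castLE h (Fin.natAdd a i)), x.2 (Fin.castLE h (Fin.natAdd a i))))) B ^ (1 - θ) ≤ (μ.map (fun x => fun i : Fin (n + 1)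 => (x.1 (Fin.castLE h (Fin.natAdd a i)), x.2 (Fin.castLE h (Fin.natAdd a i))))) {z | ∃ x ∈ A, ∃ y ∈ B, z = θ • x + (1 - θ) • y}

/-- item stmt-AtomisticToContinuum-13978 · crux · rank 4 · open · by planner
why it might fail: no N-uniform moment bound is known for any Hamiltonian-bulk chain (Bernardin2014 §2: 'polynomial in N'); Lyapunov constants of CEHR2018 grow with N; pinnedChain is the borderline degree 4 = 4 of condition C5.
sources: Bernardin2014, CuneoEckmannHairerReyBellet2018, HairerMattingly2009, EckmannPilletReyBellet1999b
[crux] N- AND SITE-UNIFORM MOMENT BOUNDS (card M1; identical to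
SingleThermostatRigidity/ParityLiouville stmt-3257): for all parameters > 0, T_L, T_R > 0 and every
m there is C with ∫(|q_i|^m + |p_i|^m) dμ ≤ C for every N, every weak steady state μ of the N-chain
and every site i. Supplies tightness and uniform integrability (cubic forces, quartic currents) for
WindowLimit. [difficulty: L] -/
@[route_item "route-AtomisticToContinuum-LogConcaveRigidity", crux]
def NessTightness : Prop :=
  ∀ ω₂ lam β γ : ℝ, 0 < ω₂ → 0 < lam → 0 < β → 0 < γ → ∀ T_L T_R : ℝ, 0 < T_L → 0 < T_R → ∀ m : ℕ, ∃ C : ℝ, ∀ (N : ℕ) (μ : MeasureTheory.Measure (Literature.MathematicalPhysics.KineticTheory.HeatConduction.PhaseSpace N)), (Literature.MathematicalPhysics.KineticTheory.HeatConduction.pinnedChain ω₂ lam β γ).IsSteadyState N T_L T_R μ → ∀ i : Fin N, MeasureTheory.Integrable (fun x => |x.1 i| ^ m + |x.2 i| ^ m) μ ∧ ∫ x, (|x.1 i| ^ m + |x.2 i| ^ m) ∂μ ≤ C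

/-- item stmt-AtomisticToContinuum-13979 · crux · rank 5 · open · by planner
why it might fail: fails iff the linear regime shrinks with N (conductance a function of Nδ, a bias-generated mean free path ~1/δ as at T→0); nonlinear response does scale with N at large bias (He–Ai–Chan–Hu 2010, NDTR); no N-uniform bound on any NESS response exists.
sources: doi:10.1103/physreve.81.041131, KunduDharNarayan2009, BonettoLebowitzReyBellet2000
[crux] N-UNIFORM LINEAR REGIME OF THE PER-BOND CURRENT (new; the bridge from fixed bias to BLR's δ →
0 first, stated in the weakest form `closes` needs): under weak-NESS uniqueness, for every steady
family, T > 0 and response coefficients D_N: ∀ ε > 0 ∃ δ₀ > 0 such that for every 0 < δ < δ₀, for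
all sufficiently large N (threshold may depend on δ), |totalCurrent(μ_{N,T+δ/2,T−δ/2})/δ − D_N| ≤ εN
— i.e. lim_{δ↓0} limsup_N |J̃_N(δ)/δ − G_N| = 0 with G_N = D_N/(N−1) the conductance: the large-N
nonlinear defect of the per-bond current vanishes with the bias. Diffusive picture: the defect is
O(δ²/N) (J̃_N ≈ N⁻¹∫_{T−δ/2}^{T+δ/2}κ, odd in δ); ballistic member: exactly 0. With the rung it
gives NonBallistic (stmt-2192) inside `closes`. [difficulty: L] -/
@[route_item "route-AtomisticToContinuum-LogConcaveRigidity", crux]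
def UniformLinearRegime : Prop :=
  ∀ ω₂ lam β γ : ℝ, 0 < ω₂ → 0 < lam → 0 < β → 0 < γ → (∀ (N : ℕ) (T_L T_R : ℝ), 0 < T_L → 0 < T_R → ∀ μ ν : MeasureTheory.Measure (Literature.MathematicalPhysics.KineticTheory.HeatConduction.PhaseSpace N), (Literature.MathematicalPhysics.KineticTheory.HeatConduction.pinnedChain ω₂ lam β γ).IsSteadyState N T_L T_R μ → (Literature.MathematicalPhysics.KineticTheory.HeatConduction.pinnedChain ω₂ lam β γ).IsSteadyState N T_L T_R ν → μ = ν) → ∀ μ : (N : ℕ) → ℝ → ℝ → MeasureTheory.Measure (Literature.MathematicalPhysics.KineticTheory.HeatConduction.PhaseSpace N), (∀ (N : ℕ) (T_L T_R : ℝ), 0 < T_L → 0 < T_R → (Literature.MathematicalPhysics.KineticTheory.HeatConduction.pinnedChain ω₂ lam β γ).IsSteadyState N T_L T_R (μ N T_L T_R)) → ∀ T : ℝ, 0 < T → ∀ D : ℕ → ℝ, (∀ N : ℕ, Filter.Tendsto (fun δ : ℝ => (Literature.MathematicalPhysics.KineticTheory.HeatConduction.pinnedChain ω₂ lam β γ).totalCurrent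 (μ N (T + δ / 2) (T - δ / 2)) / δ) (nhdsWithin 0 {(0 : ℝ)}ᶜ) (nhds (D N))) → ∀ ε : ℝ, 0 < ε → ∃ δ₀ : ℝ, 0 < δ₀ ∧ ∀ δ : ℝ, 0 < δ → δ < δ₀ → ∀ᶠ N : ℕ in Filter.atTop, |(Literature.MathematicalPhysics.KineticTheory.HeatConduction.pinnedChain ω₂ lam β γ).totalCurrent (μ N (T + δ / 2) (T - δ / 2)) / δ - D N| ≤ ε * (N : ℝ)

/-- item stmt-AtomisticToContinuum-11748 · crux · rank 6 · open · by planner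
why it might fail: junction-repair cost may grow with N, M if optimal response fields carry junction-crossing coherent structure at all scales (long mean free path; C(T)↑∞ as T→0 must be allowed); no sign principle is known; fails exactly for superdiffusive transport.
sources: GaudilliereLandim2013, ReyBellet2003, Hammersley1988, arXiv:1105.0493
[crux] under weak-NESS uniqueness, for every steady-state family of pinnedChain ω₂ lam β γ (all >
0), every T > 0 and response coefficients D_N > 0 (N ≥ 2): ∃ C = C(ω₂,lam,β,γ,T) with R_{N+M} ≥ R_N
+ R_M − C for all N, M ≥ 2, R_N := (N−1)/D_N (card item K1; = InsertionCost of
insertion-cost-superadditive-half). Bounded reservoir-insertion cost: cutting the chain and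
re-thermalising the cut raises the end-to-end resistance by at most a contact constant. Arena:
Dirichlet/Thomson saddle representation of D_N for L = A_H + γS_baths + a junction-repair lemma
gluing near-optimal admissible pairs of the two bathed halves across the deterministic bond at cost
≤ C uniformly in N, M (admissible classes are bulk-invariant, arXiv:1105.0493 §6); other engines:
thermostat interpolation at the junction, contact cross-correlations. NOT implied by FouriersLaw (it
carries the 1/N rate): the bet. Trivial at lam = β = 0 (HarmonicCalibration). [difficulty: XL] -/
@[route_item "route-AtomisticToContinuum-LogConcaveRigidity", crux]
def SuperadditiveResistance : Prop :=
  ∀ ω₂ lam β γ : ℝ, 0 < ω₂ → 0 < lam → 0 < β → 0 < γ → (∀ (N : ℕ) (T_L T_R : ℝ), 0 < T_L → 0 < T_R → ∀ μ ν : MeasureTheory.Measure (Literature.MathematicalPhysics.KineticTheory.HeatConduction.PhaseSpace N), (Literature.MathematicalPhysics.KineticTheory.HeatConduction.pinnedChain ω₂ lam β γ).IsSteadyState N T_L T_R μ → (Literature.MathematicalPhysics.KineticTheory.HeatConduction.pinnedChain ω₂ lam β γ).IsSteadyState N T_L T_R ν → μ = ν) → ∀ μ : (N : ℕ) → ℝ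 → ℝ → MeasureTheory.Measure (Literature.MathematicalPhysics.KineticTheory.HeatConduction.PhaseSpace N), (∀ (N : ℕ) (T_L T_R : ℝ), 0 < T_L → 0 < T_R → (Literature.MathematicalPhysics.KineticTheory.HeatConduction.pinnedChain ω₂ lam β γ).IsSteadyState N T_L T_R (μ N T_L T_R)) → ∀ T : ℝ, 0 < T → ∀ D : ℕ → ℝ, (∀ N : ℕ, Filter.Tendsto (fun δ : ℝ => (Literature.MathematicalPhysics.KineticTheory.HeatConduction.pinnedChain ω₂ lam β γ).totalCurrent (μ N (T + δ / 2) (T - δ / 2)) / δ) (nhdsWithin 0 {(0 : ℝ)}ᶜ) (nhds (D N))) → (∀ N : ℕ, 2 ≤ N → 0 < D N) → ∃ C : ℝ, ∀ N M : ℕ, 2 ≤ N → 2 ≤ M → ((N : ℝ) - 1) / D N + ((M : ℝ) - 1) / D M - C ≤ ((N : ℝ) + (M : ℝ) - 1) / D (N + M)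

/-- item stmt-AtomisticToContinuum-11749 · crux · rank 9 · open · by planner
why it might fail: an asymptotically localised regime (pinning ≫ coupling at high T, DeRoeckHuveneers2015) makes c(T) smaller than any power of the effective coupling; nothing in print forbids c = 0 at a given T; no lower-bound technology exists without bulk noise.
sources: DeRoeckHuveneers2015, BernardinOlla2005, BonettoLebowitzReyBellet2000
[crux] under weak-NESS uniqueness, for every steady-state family of pinnedChain ω₂ lam β γ (all >
0), T > 0 and the response coefficients D_N: ∃ c = c(ω₂,lam,β,γ,T) > 0 and N₁ with D_N ≥ c for all N
≥ N₁ (liminf_N D_N > 0; an Ohmic LOWER bound J_N ≥ c·δT/(N−1) to first order; card item K3's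
positivity half). NECESSARY for the conjunct (D_N → κ(T) > 0). In the glue it caps the Fekete slope
(R_N/N ≤ 1/c), i.e. κ ≥ c. No N-uniform lower bound on the NESS current of a deterministic
anharmonic chain is in print; candidate engines: linear-response fluctuation-theorem / uncertainty
bounds, comparison with the energy-conserving-noise chain where κ ≥ c is a theorem
(BernardinOlla2005, BasileBernardinOlla2009), multi-scale pigeonhole on the response temperature
profile (card anti-insulator-kink-rigidity); ALTERNATIVE SUPPLIER: the companion SUBadditive half
(card fekete-resistance-subadditivity: R_{N+M} ≤ R_N + R_M + C' and D_2 > 0 give R_N ≤ K·N, hence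
D_N ≥ 1/(2K)). [difficulty: XL] -/
@[route_item "route-AtomisticToContinuum-LogConcaveRigidity", crux]
def ConductanceLowerBound : Prop :=
  ∀ ω₂ lam β γ : ℝ, 0 < ω₂ → 0 < lam → 0 < β → 0 < γ → (∀ (N : ℕ) (T_L T_R : ℝ), 0 < T_L → 0 < T_R → ∀ μ ν : MeasureTheory.Measure (Literature.MathematicalPhysics.KineticTheory.HeatConduction.PhaseSpace N), (Literature.MathematicalPhysics.KineticTheory.HeatConduction.pinnedChain ω₂ lam β γ).IsSteadyState N T_L T_R μ → (Literature.MathematicalPhysics.KineticTheory.HeatConduction.pinnedChain ω₂ lam β γ).IsSteadyState N T_L T_R ν → μ = ν) → ∀ μ : (N : ℕ) → ℝ → ℝ → MeasureTheory.Measure (Literature.MathematicalPhysics.KineticTheory.HeatConduction.PhaseSpace N), (∀ (N : ℕ) (T_L T_R : ℝ), 0 < T_L → 0 < T_R → (Literature.MathematicalPhysics.KineticTheory.HeatConduction.pinnedChain ω₂ lam β γ).IsSteadyState N T_L T_R (μ N T_L T_R)) → ∀ T : ℝ, 0 < T → ∀ D : ℕ → ℝ, (∀ N : ℕ, Filter.Tendsto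 (fun δ : ℝ => (Literature.MathematicalPhysics.KineticTheory.HeatConduction.pinnedChain ω₂ lam β γ).totalCurrent (μ N (T + δ / 2) (T - δ / 2)) / δ) (nhdsWithin 0 {(0 : ℝ)}ᶜ) (nhds (D N))) → ∃ c : ℝ, 0 < c ∧ ∃ N₁ : ℕ, ∀ N : ℕ, N₁ ≤ N → c ≤ D N

/-- item stmt-AtomisticToContinuum-16562 · crux · rank 9 · open · by planner
why it might fail: glue-crux, provable (M): fails only by a convention mismatch between the finite-N window map (Fin.castLE ∘ Fin.natAdd) and boxRestrictAt, or if Borell closedness is attempted without the compact-set/ε-neighbourhood step and inner regularity.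
sources: Borell1975, BrascampLieb1976, SaumardWellner2014, EyinkLebowitzSpohn1991, KipnisLandim1999
[support] BULK-WINDOW COMPACTNESS INSIDE THE LOG-CONCAVE CLASS (the log-concave twin of the proved
WindowLimit stmt-AtomisticToContinuum-13982): for any parameters, any family (μ_N) of weak steady
states at (T_L,T_R) with site-uniform moments whose finite-N windows all satisfy Borell's
inequality, if frequently ε ≤ |totalCurrent(μ_N)/(N−1)| then some probability ν on (ℝ×ℝ)^ℤ is
time-invariant, translation-bounded, WINDOW-LOG-CONCAVE (Borell), with j₀ integrable and ε ≤ |∫ j₀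
dν|. Proof plan: windows centred at ⌊N/2⌋, Prokhorov from moments, stationarity transfer exactly as
in windowLimit_proof (bath terms do not touch bulk coordinates; bond currents of a steady state all
equal J̃_N), and Borell closedness: weak limits of measures satisfying the multiplicative
Brunn–Minkowski inequality satisfy it (compact A, B via ε-neighbourhoods and limsup on closed sets,
then inner regularity), and projections to sub-windows preserve it (Prékopa in Borell form is just
the image under a linear map). [difficulty: M] -/
@[route_item "route-AtomisticToContinuum-LogConcaveRigidity", crux]
def LogConcaveWindowLimit : Prop :=
  ∀ (ω₂ lam β γ T_L T_R : ℝ) (μ : (N : ℕ) → MeasureTheory.Measure (Literature.MathematicalPhysics.KineticTheory.HeatConduction.PhaseSpace N)), (∀ N, (Literature.MathematicalPhysics.KineticTheory.HeatConduction.pinnedChain ω₂ lam β γ).IsSteadyState N T_L T_R (μ N)) → (∀ m : ℕ, ∃ C : ℝ, ∀ (N : ℕ) (i : Fin N), MeasureTheory.Integrable (fun x => |x.1 i| ^ m + |x.2 i| ^ m) (μ N) ∧ ∫ x, (|x.1 i| ^ m + |x.2 i| ^ m) ∂(μ N) ≤ C) → (∀ (N a n : ℕ) (h : a + (n + 1)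 ≤ N), ∀ (A B : Set (Fin (n + 1) → ℝ × ℝ)) (θ : ℝ), MeasurableSet A → MeasurableSet B → 0 < θ → θ < 1 → ((μ N).map (fun x => fun i : Fin (n + 1) => (x.1 (Fin.castLE h (Fin.natAdd a i)), x.2 (Fin.castLE h (Fin.natAdd a i))))) A ^ θ * ((μ N).map (fun x => fun i : Fin (n + 1) => (x.1 (Fin.castLE h (Fin.natAdd a i)), x.2 (Fin.castLE h (Fin.natAdd a i))))) B ^ (1 - θ) ≤ ((μ N).map (fun x => fun i : Fin (n + 1) => (x.1 (Fin.castLE h (Fin.natAdd a i)), x.2 (Fin.castLE h (Fin.natAdd a i))))) {z | ∃ x ∈ A, ∃ y ∈ B, z = θ • x + (1 - θ) • y}) → ∀ ε : ℝ, 0 < ε → (∃ᶠ N in Filter.atTop, ε ≤ |(Literature.MathematicalPhysics.KineticTheory.HeatConduction.pinnedChain ω₂ lam β γ).totalCurrent (μ N) / ((N : ℝ) - 1)|) → ∃ ν : MeasureTheory.Measure Literature.MathematicalPhysics.KineticTheory.HeatConduction.ChainConfig, MeasureTheory.IsProbabilityMeasure ν ∧ Literature.MathematicalPhysics.KineticTheory.HeatConduction.IsTimeInvariant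 (Literature.MathematicalPhysics.KineticTheory.HeatConduction.pinnedChain ω₂ lam β γ) ν ∧ (∀ m : ℕ, ∃ C : ℝ, ∀ x : ℤ, MeasureTheory.Integrable (fun σ => |(σ x).1| ^ m + |(σ x).2| ^ m) ν ∧ ∫ σ, (|(σ x).1| ^ m + |(σ x).2| ^ m) ∂ν ≤ C) ∧ (∀ (a : ℤ) (n : ℕ), ∀ (A B : Set (Fin (n + 1) → ℝ × ℝ)) (θ : ℝ), MeasurableSet A → MeasurableSet B → 0 < θ → θ < 1 → (Literature.MathematicalPhysics.KineticTheory.HeatConduction.boxMarginal a n ν) A ^ θ * (Literature.MathematicalPhysics.KineticTheory.HeatConduction.boxMarginal a n ν) B ^ (1 - θ) ≤ (Literature.MathematicalPhysics.KineticTheory.HeatConduction.boxMarginal a n ν) {z | ∃ x ∈ A, ∃ y ∈ B, z = θ • x + (1 - θ) • y}) ∧ MeasureTheory.Integrable (fun σ => (Literature.MathematicalPhysics.KineticTheory.HeatConduction.pinnedChain ω₂ lam β γ).bondCurrentZ σ 0) ν ∧ ε ≤ |∫ σ, (Literature.MathematicalPhysics.KineticTheory.HeatConduction.pinnedChain ω₂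 lam β γ).bondCurrentZ σ 0 ∂ν|

-- earlier Assembly (stmt-AtomisticToContinuum-16568, replaced 2026-08-16T19:34:32Z -> stmt-AtomisticToContinuum-16574): retired by None — NessUnique → PinnedSteadyStateExists → FiniteResponseOfUnique → PositiveConductance → ConductanceLowerBound → SuperadditiveResistance → SuperadditiveFekete → LogConcaveLiouville → NessWindowLogConcavity → NessTightness → LogConcaveWindowLimit → UniformLinearRegime
/-- item stmt-AtomisticToContinuum-16574 · assembly · rank 1 · open · by planner
sources: BonettoLebowitzReyBellet2000, FritzFunakiLebowitz1994, Hammersley1988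
[assembly] LogConcaveLiouville → NessWindowLogConcavity → NessTightness → UniformLinearRegime →
SuperadditiveResistance → ConductanceLowerBound → LogConcaveWindowLimit → FouriersLaw — the type of
the proved crux-only `closes` (the five fixed-N / Fekete frame Props are invoked from the tree
inside its proof). -/
@[route_item "route-AtomisticToContinuum-LogConcaveRigidity"]
def Assembly : Prop :=
  LogConcaveLiouville → NessWindowLogConcavity → NessTightness → UniformLinearRegime → SuperadditiveResistance → ConductanceLowerBound → LogConcaveWindowLimit → _root_.FouriersLaw

/-! D-0027 §2.1 — DECIDING THEOREM (planner-authored via `route open/edit --closes-file`; by planner-rbadge-AtomisticToContinuum-LogConcave-80ed8c03-0 2026-08-16T19:38:41Z):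
its hypotheses are this route's items and its conclusion the sub-problem Statement (glue_lint), and it elaborates with this file. -/

@[closes "route-AtomisticToContinuum-LogConcaveRigidity"] theorem closes (hLCL : LogConcaveLiouville) (hNLC : NessWindowLogConcavity) (hT : NessTightness)
    (hU : UniformLinearRegime) (hA : SuperadditiveResistance) (hCL : ConductanceLowerBound)
    (hW : LogConcaveWindowLimit) : _root_.FouriersLaw := by
  -- the five fixed-N / real-analysis supports are PROVED in tree (other routes' Theorems files, same Props verbatim):
  have hNU := Summit.AtomisticToContinuum.FouriersLaw.Theorems.nessUnique_proof
  have hE := Summit.AtomisticToContinuum.FouriersLaw.Theorems.pinnedSteadyStateExists_proof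
  have hFR := Summit.AtomisticToContinuum.FouriersLaw.Theorems.FourierGreenKubo.finiteResponseOfUnique_holds
  have hP :=
    Summit.AtomisticToContinuum.FouriersLaw.Cruxes.BoundedResponseConverges.TwoScaleGluingLogRigidity.Stubs.positiveConductance_holds
  have hF := Summit.AtomisticToContinuum.FouriersLaw.Theorems.superadditiveFekete_proof
  intro ω₂ lam β γ hω hl hβ hγ
  have huniq := hNU ω₂ lam β γ hω hl hβ hγ
  have hex := hE ω₂ lam β γ hω hl hβ hγ
  refine ⟨fun N T_L T_R hL' hR' => ?_, ?_⟩
  · obtain ⟨μ, hμ⟩ := hex N T_L T_R hL' hR'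
    exact ⟨μ, hμ, fun ν hν => huniq N T_L T_R hL' hR' ν μ hν hμ⟩
  -- STEP A: the anti-ballistic rung NEAR EQUILIBRIUM (bias below the log-concavity width δ₀(T)),
  -- for every steady family: window log-concavity + tightness ⇒ log-concave window limits ⇒ Liouville kills the current
  have antiB : ∀ T : ℝ, 0 < T → ∃ δ₁ : ℝ, 0 < δ₁ ∧ ∀ δ : ℝ, 0 < δ → δ < δ₁ → 0 < T - δ / 2 →
      ∀ ν : (N : ℕ) → MeasureTheory.Measure (Literature.MathematicalPhysics.KineticTheory.HeatConduction.PhaseSpace N),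
        (∀ N, (Literature.MathematicalPhysics.KineticTheory.HeatConduction.pinnedChain ω₂ lam β γ).IsSteadyState N
          (T + δ / 2) (T - δ / 2) (ν N)) →
        Filter.Tendsto (fun N : ℕ =>
          (Literature.MathematicalPhysics.KineticTheory.HeatConduction.pinnedChain ω₂ lam β γ).totalCurrent (ν N) / ((N : ℝ) - 1))
          Filter.atTop (nhds 0) := by
    intro T hTpos
    obtain ⟨δ₀, hδ₀, hLCδ⟩ := hNLC ω₂ lam β γ hω hl hβ hγ T hTpos
    refine ⟨δ₀, hδ₀, fun δ hδ hδlt hR ν hν => ?_⟩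
    have hL : 0 < T + δ / 2 := by linarith
    by_contra hnot
    rw [Metric.tendsto_nhds] at hnot
    push Not at hnot
    obtain ⟨ε, hε, hnev⟩ := hnot
    have hfreq : ∃ᶠ N in Filter.atTop,
        ε ≤ |(Literature.MathematicalPhysics.KineticTheory.HeatConduction.pinnedChain ω₂ lam β γ).totalCurrent (ν N) / ((N : ℝ) - 1)| := by
      refine hnev.mono fun N hN => ?_
      have hN' : ε ≤ dist ((Literature.MathematicalPhysics.KineticTheory.HeatConduction.pinnedChain ω₂ lam β γ).totalCurrent (ν N) /
          ((N : ℝ) - 1)) 0 := hN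
      rwa [Real.dist_0_eq_abs] at hN'
    -- moments of the family, from NessTightness
    have hmom : ∀ m : ℕ, ∃ C : ℝ, ∀ (N : ℕ) (i : Fin N),
        MeasureTheory.Integrable (fun x => |x.1 i| ^ m + |x.2 i| ^ m) (ν N) ∧
          ∫ x, (|x.1 i| ^ m + |x.2 i| ^ m) ∂(ν N) ≤ C := by
      intro m
      obtain ⟨C, hC⟩ := hT ω₂ lam β γ hω hl hβ hγ (T + δ / 2) (T - δ / 2) hL hR m
      exact ⟨C, fun N i => hC N (ν N) (hν N) i⟩
    -- window log-concavity of the family, from NessWindowLogConcavity below the width δ₀(T)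
    have hlc : ∀ (N a n : ℕ) (h : a + (n + 1) ≤ N) (A B : Set (Fin (n + 1) → ℝ × ℝ)) (θ : ℝ),
        MeasurableSet A → MeasurableSet B → 0 < θ → θ < 1 →
        ((ν N).map (fun x => fun i : Fin (n + 1) =>
            (x.1 (Fin.castLE h (Fin.natAdd a i)), x.2 (Fin.castLE h (Fin.natAdd a i))))) A ^ θ *
          ((ν N).map (fun x => fun i : Fin (n + 1) =>
            (x.1 (Fin.castLE h (Fin.natAdd a i)), x.2 (Fin.castLE h (Fin.natAdd a i))))) B ^ (1 - θ) ≤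
          ((ν N).map (fun x => fun i : Fin (n + 1) =>
            (x.1 (Fin.castLE h (Fin.natAdd a i)), x.2 (Fin.castLE h (Fin.natAdd a i)))))
            {z | ∃ x ∈ A, ∃ y ∈ B, z = θ • x + (1 - θ) • y} :=
      fun N a n h A B θ hA hB hθ hθ1 => hLCδ δ hδ hδlt hR N (ν N) (hν N) a n h A B θ hA hB hθ hθ1
    obtain ⟨νi, hprob, htime, hmomi, hlci, hint, hεle⟩ :=
      hW ω₂ lam β γ (T + δ / 2) (T - δ / 2) ν hν hmom hlc ε hε hfreq
    have hzero := hLCL ω₂ lam β γ hω hl hβ νi hprob htime hmomi hlci hint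
    rw [hzero, abs_zero] at hεle
    exact absurd hεle (not_le.2 hε)
  -- STEP B: canonical family, and for each T > 0 the response limit
  classical
  let μ₀ : (N : ℕ) → ℝ → ℝ →
      MeasureTheory.Measure (Literature.MathematicalPhysics.KineticTheory.HeatConduction.PhaseSpace N) :=
    fun N T_L T_R => if h : 0 < T_L ∧ 0 < T_R then Classical.choose (hex N T_L T_R h.1 h.2) else 0
  have hμ₀ : ∀ (N : ℕ) (T_L T_R : ℝ), 0 < T_L → 0 < T_R →
      (Literature.MathematicalPhysics.KineticTheory.HeatConduction.pinnedChain ω₂ lam β γ).IsSteadyState N T_L T_R (μ₀ N T_L T_R) := by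
    intro N T_L T_R hL' hR'
    simp only [μ₀, dif_pos (And.intro hL' hR')]
    exact Classical.choose_spec (hex N T_L T_R hL' hR')
  have key : ∀ T : ℝ, 0 < T → ∃ κT : ℝ, 0 < κT ∧ ∃ D : ℕ → ℝ,
      (∀ N : ℕ, Filter.Tendsto (fun δ : ℝ =>
        (Literature.MathematicalPhysics.KineticTheory.HeatConduction.pinnedChain ω₂ lam β γ).totalCurrent
          (μ₀ N (T + δ / 2) (T - δ / 2)) / δ) (nhdsWithin 0 {(0 : ℝ)}ᶜ) (nhds (D N))) ∧
      Filter.Tendsto D Filter.atTop (nhds κT) := by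
    intro T hTpos
    have hDex := hFR ω₂ lam β γ hω hl hβ hγ huniq μ₀ hμ₀ T hTpos
    choose D hD using hDex
    have hpos : ∀ N : ℕ, 2 ≤ N → 0 < D N := hP ω₂ lam β γ hω hl hβ hγ huniq μ₀ hμ₀ T hTpos D hD
    obtain ⟨c, hc, N₁, hN₁⟩ := hCL ω₂ lam β γ hω hl hβ hγ huniq μ₀ hμ₀ T hTpos D hD
    obtain ⟨C, hsuper⟩ := hA ω₂ lam β γ hω hl hβ hγ huniq μ₀ hμ₀ T hTpos D hD hpos
    obtain ⟨δ₁, hδ₁, hanti⟩ := antiB T hTpos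
    -- NOT BALLISTIC at linear response, from the near-equilibrium rung + the uniform linear regime
    have hNB : ∀ ε : ℝ, 0 < ε → ∀ N₀ : ℕ, ∃ N : ℕ, N₀ ≤ N ∧ D N ≤ ε * ((N : ℝ) - 1) := by
      intro ε hε N₀
      obtain ⟨δ₀, hδ₀, hUδ⟩ := hU ω₂ lam β γ hω hl hβ hγ huniq μ₀ hμ₀ T hTpos D hD (ε / 4) (by positivity)
      set δ : ℝ := min (min (δ₀ / 2) T) (δ₁ / 2) with hδdef
      have hδpos : 0 < δ := lt_min (lt_min (by positivity) hTpos) (by positivity)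
      have hδle1 : δ ≤ min (δ₀ / 2) T := min_le_left _ _
      have hδlt : δ < δ₀ := lt_of_le_of_lt (le_trans hδle1 (min_le_left _ _)) (by linarith)
      have hδT : δ ≤ T := le_trans hδle1 (min_le_right _ _)
      have hδlt1 : δ < δ₁ := lt_of_le_of_lt (min_le_right _ _) (by linarith)
      have h1 : 0 < T + δ / 2 := by linarith
      have h2 : 0 < T - δ / 2 := by linarith
      have hfam : ∀ N, (Literature.MathematicalPhysics.KineticTheory.HeatConduction.pinnedChain ω₂ lam β γ).IsSteadyState N
          (T + δ / 2) (T - δ / 2) (μ₀ N (T + δ / 2) (T - δ / 2)) := fun N => hμ₀ N _ _ h1 h2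
      have hlim := hanti δ hδpos hδlt1 h2 (fun N => μ₀ N (T + δ / 2) (T - δ / 2)) hfam
      have hev : ∀ᶠ N : ℕ in Filter.atTop, dist
          ((Literature.MathematicalPhysics.KineticTheory.HeatConduction.pinnedChain ω₂ lam β γ).totalCurrent
            (μ₀ N (T + δ / 2) (T - δ / 2)) / ((N : ℝ) - 1)) 0 < ε / 4 * δ :=
        Metric.tendsto_nhds.1 hlim _ (by positivity)
      have hUev : ∀ᶠ N : ℕ in Filter.atTop,
          |(Literature.MathematicalPhysics.KineticTheory.HeatConduction.pinnedChain ω₂ lam β γ).totalCurrent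
              (μ₀ N (T + δ / 2) (T - δ / 2)) / δ - D N| ≤ ε / 4 * (N : ℝ) := hUδ δ hδpos hδlt
      obtain ⟨N, hNge, hNd, hUN⟩ := ((Filter.eventually_ge_atTop (max N₀ 2)).and (hev.and hUev)).exists
      have hN₀ : N₀ ≤ N := le_trans (le_max_left _ _) hNge
      have hN2 : 2 ≤ N := le_trans (le_max_right _ _) hNge
      have hN2r : (2 : ℝ) ≤ (N : ℝ) := by exact_mod_cast hN2
      refine ⟨N, hN₀, ?_⟩
      set t : ℝ := (Literature.MathematicalPhysics.KineticTheory.HeatConduction.pinnedChain ω₂ lam β γ).totalCurrent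
          (μ₀ N (T + δ / 2) (T - δ / 2)) with htdef
      rw [Real.dist_0_eq_abs] at hNd
      have hNm1 : 0 < (N : ℝ) - 1 := by linarith
      have ht : |t| < ε / 4 * δ * ((N : ℝ) - 1) := by
        rw [abs_div, abs_of_pos hNm1, div_lt_iff₀ hNm1] at hNd
        exact hNd
      have htδ : |t / δ| < ε / 4 * ((N : ℝ) - 1) := by
        rw [abs_div, abs_of_pos hδpos, div_lt_iff₀ hδpos]
        calc |t| < ε / 4 * δ * ((N : ℝ) - 1) := ht
          _ = ε / 4 * ((N : ℝ) - 1) * δ := by ring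
      have hDle : D N ≤ |t / δ - D N| + |t / δ| := by
        have := abs_sub_abs_le_abs_sub (D N) (t / δ)
        have h' : D N ≤ |D N| := le_abs_self _
        rw [abs_sub_comm] at this
        linarith
      have hNle : (N : ℝ) ≤ 2 * ((N : ℝ) - 1) := by linarith
      calc D N ≤ |t / δ - D N| + |t / δ| := hDle
        _ ≤ ε / 4 * (N : ℝ) + ε / 4 * ((N : ℝ) - 1) := by linarith [hUN, htδ.le]
        _ ≤ ε / 4 * (2 * ((N : ℝ) - 1)) + ε / 4 * ((N : ℝ) - 1) := by gcongr
        _ ≤ ε * ((N : ℝ) - 1) := by nlinarith [hNm1, hε]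
    obtain ⟨κT, hκpos, hκ⟩ := hF D C c hc hpos ⟨N₁, hN₁⟩ hsuper hNB
    exact ⟨κT, hκpos, D, hD, hκ⟩
  -- STEP C: the conductivity function and the transfer to every steady-state family
  choose κf hκpos Df hDf hDlim using key
  refine ⟨fun T => if hT : 0 < T then κf T hT else 1, fun T hT => ?_, ?_⟩
  · simp only [dif_pos hT]; exact hκpos T hT
  intro μ hμ T hT
  refine ⟨Df T hT, fun N => ?_, ?_⟩
  · refine (hDf T hT N).congr' ?_
    have h2 : ∀ᶠ δ in nhds (0 : ℝ), δ < 2 * T := eventually_lt_nhds (by linarith)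
    have h2' : ∀ᶠ δ in nhds (0 : ℝ), -(2 * T) < δ := eventually_gt_nhds (by linarith)
    filter_upwards [mem_nhdsWithin_of_mem_nhds h2, mem_nhdsWithin_of_mem_nhds h2'] with δ hlt hgt
    have ha : 0 < T + δ / 2 := by linarith
    have hb : 0 < T - δ / 2 := by linarith
    rw [huniq N _ _ ha hb (μ₀ N _ _) (μ N _ _) (hμ₀ N _ _ ha hb) (hμ N _ _ ha hb)]
  · simp only [dif_pos hT]; exact hDlim T hT

end Summit.AtomisticToContinuum.FouriersLaw.Theses.LogConcaveRigidity
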